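import Literature.AlgebraicGeometry.Resolution.MacaulayficationKawasakiStepFiveB
import HarnessLib

/-!
# Kawasaki's interwoven induction, Step 6 (Kawasaki 2000, proof of Thm. 3.1)

Topic: `Literature/AlgebraicGeometry/Resolution`. Brick of the proof of the named facts
`KawasakiMacaulayfication` / `CesnaviciusMacaulayfication`; sequel of
`MacaulayficationKawasakiStepFiveB.lean`. Step 6 of the printed proof of Kawasaki 2000, Thm. 3.1
(pp. 2526–2527): **if `j > i`, then `(C_ij)` comes from `(B_ij)`, `(C_ii)`, `(C_{i+1,j})` and
`(E_{i+1,j})`.**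

* `Kawasaki.b31_reduce`, `Kawasaki.b31_iterate_gen` — "In the same way as Step 3, we may assume
  that `nᵢ = ⋯ = nⱼ = 1`": iterating the case `l = d` of `(B_ij)`,
  `[(Y)M + q^nM] : y_u = (∏ q_t^{n_t-1})·{[(Y)M + qᵢ⋯qⱼM] : y_u} + (Y)M : y_u`;
* `IsPStandard.kawasaki317` — the auxiliary equality **(3.1.7)**
  `(Y, xᵢ)M : y_u ∩ (Y, xᵢ,…,x_l)M = (Y, xᵢ)M` (by (2.9.2), induction on `l`);
* `IsPStandard.kawasakiC31_ones` — `(3.1.3)` with all exponents `1`, as printed (via `(C_{i+1,j})`,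
  `(C_ii)`, (3.1.7) and `(E_{i+1,j})`, two applications of the modular law);
* `IsPStandard.kawasakiC31_of_succ` — `(C_ij)`.

Everything is proved; no named fact is introduced.

## References

* [Kawasaki2000] T. Kawasaki, *On Macaulayfication of Noetherian schemes*, Trans. AMS 352 (2000)
  2517–2552, proof of Thm. 3.1, Step 6 (pp. 2526–2527).
-/

namespace Literature.AlgebraicGeometry.Resolution

open Ideal Submodule Module IsLocalRing
open scoped Pointwise

universe u v


variable {R : Type u} [CommRing R] [IsLocalRing R]
variable {M : Type v} [AddCommGroup M] [Module R M]

namespace Kawasaki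

variable {xs : List R} {i j : ℕ}

/-- **Reducing one exponent to `1` with `(B_ij)`** (the case `l = d` of `(B_ij)`, iterated at the
index `k`): `[(Y)M + q^nM] : y_u = q_k^{n_k - 1}·{[(Y)M + q^{n'}M] : y_u} + (Y)M : y_u` where
`n' = n` except `n'_k = 1`. [cite: Kawasaki2000, Thm. 3.1, Step 6] -/
theorem b31_reduce (hB : B31 M xs i j) (hj : j < xs.length) {Y : List R} {yu : R}
    (hys : IsSecantSequence M (xs.drop i ++ (Y ++ [yu]))) (hym : ∀ y ∈ Y ++ [yu], y ∈ maximalIdeal R)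
    {k : ℕ} (hk : k ∈ Finset.Icc i j) {n : ℕ → ℕ} (hn : PosOn n i j) :
    colonBy (ofList Y • ⊤ ⊔ prodPow xs n i j • ⊤ : Submodule R M) yu =
      tailIdeal xs k ^ (n k - 1) • colonBy (ofList Y • ⊤ ⊔ prodPow xs (Function.update n k 1) i j • ⊤ :
        Submodule R M) yu ⊔ colonBy (ofList Y • ⊤ : Submodule R M) yu := by
  classical
  have hk' := Finset.mem_Icc.mp hk
  suffices key : ∀ (e : ℕ) (n : ℕ → ℕ), PosOn n i j → n k = e + 1 →
      colonBy (ofList Y • ⊤ ⊔ prodPow xs n i j • ⊤ : Submodule R M) yu =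
        tailIdeal xs k ^ e • colonBy (ofList Y • ⊤ ⊔ prodPow xs (Function.update n k 1) i j • ⊤ :
          Submodule R M) yu ⊔ colonBy (ofList Y • ⊤ : Submodule R M) yu from
    key (n k - 1) n hn (by have := hn k hk; omega)
  intro e
  induction e with
  | zero =>
    intro n hn hnk
    have hnk' : n k = 1 := hnk
    have e1 : Function.update n k 1 = n := by rw [← hnk', Function.update_eq_self]
    rw [e1, pow_zero, one_eq_top, Submodule.top_smul, eq_comm, sup_eq_left]
    exact colonBy_mono le_sup_left _
  | succ e ih =>
    intro n hn hnk
    obtain ⟨d', hd'⟩ : ∃ d', xs.length = d' + 1 := ⟨xs.length - 1, by omega⟩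
    have hnm : PosOn (Function.update n k (n k - 1)) i j := hn.update (by omega)
    -- `(B_ij)` for `n⁻` at `l = d - 1`: `E(n) = q_k · E(n⁻) + (Y)M : y_u`
    have hB' := hB (Function.update n k (n k - 1)) hnm Y yu hys hym k d' hk'.1 hk'.2 (by omega)
      (by omega)
    rw [← hd', seg_length] at hB'
    change colonBy (ofList Y • ⊤ ⊔ tailIdeal xs k • (prodPow xs (Function.update n k (n k - 1)) i j • ⊤))
      yu = tailIdeal xs k • colonBy (ofList Y • ⊤ ⊔ prodPow xs (Function.update n k (n k - 1)) i j • ⊤)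
        yu ⊔ colonBy (ofList Y • ⊤) yu at hB'
    rw [← Submodule.mul_smul, ← prodPow_eq_mul_update hk (by omega)] at hB'
    rw [hB', ih (Function.update n k (n k - 1)) hnm (by rw [Function.update_self]; omega),
      Function.update_idem, Submodule.smul_sup, ← Submodule.mul_smul, ← pow_succ', sup_assoc]
    congr 1
    exact sup_eq_right.mpr Submodule.smul_le_right

/-- **"We may assume `nᵢ = ⋯ = nⱼ = 1`"** (Kawasaki 2000, Thm. 3.1, Steps 6, 8, 9, "in the same
way as Step 3"): iterating `(B_ij)` at `l = d`,
`[(Y)M + q^nM] : y_u = (qᵢ^{nᵢ-1}⋯qⱼ^{nⱼ-1})·{[(Y)M + qᵢ⋯qⱼM] : y_u} + (Y)M : y_u`.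
[cite: Kawasaki2000, Thm. 3.1, Step 6] -/
theorem b31_iterate_gen (hB : B31 M xs i j) (hj : j < xs.length) {Y : List R} {yu : R}
    (hys : IsSecantSequence M (xs.drop i ++ (Y ++ [yu]))) (hym : ∀ y ∈ Y ++ [yu], y ∈ maximalIdeal R)
    {n : ℕ → ℕ} (hn : PosOn n i j) :
    colonBy (ofList Y • ⊤ ⊔ prodPow xs n i j • ⊤ : Submodule R M) yu =
      prodPow xs (fun t => n t - 1) i j •
          colonBy (ofList Y • ⊤ ⊔ prodPow xs (fun _ => 1) i j • ⊤ : Submodule R M) yu ⊔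
        colonBy (ofList Y • ⊤ : Submodule R M) yu := by
  classical
  -- induction on the number of indices `t ∈ [i, j]` with `n t ≠ 1`
  suffices key : ∀ (N : ℕ) (n : ℕ → ℕ), PosOn n i j →
      ((Finset.Icc i j).filter fun t => n t ≠ 1).card ≤ N →
        colonBy (ofList Y • ⊤ ⊔ prodPow xs n i j • ⊤ : Submodule R M) yu =
          prodPow xs (fun t => n t - 1) i j •
              colonBy (ofList Y • ⊤ ⊔ prodPow xs (fun _ => 1) i j • ⊤ : Submodule R M) yu ⊔
            colonBy (ofList Y • ⊤ : Submodule R M) yu from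
    key _ n hn le_rfl
  intro N
  induction N with
  | zero =>
    intro n hn hcard
    have hall : ∀ t ∈ Finset.Icc i j, n t = 1 := fun t ht => by
      by_contra h
      have : t ∈ (Finset.Icc i j).filter fun t => n t ≠ 1 := Finset.mem_filter.mpr ⟨ht, h⟩
      rw [Nat.le_zero, Finset.card_eq_zero] at hcard
      rw [hcard] at this
      exact absurd this (Finset.notMem_empty t)
    rw [prodPow_congr (n' := fun _ => 1) hall, prodPow_eq_top_of_forall_eq_zero
      (f := fun t => n t - 1) (fun t ht => by show n t - 1 = 0; rw [hall t ht]),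
      Submodule.top_smul, eq_comm, sup_eq_left]
    exact colonBy_mono le_sup_left _
  | succ N ih =>
    intro n hn hcard
    by_cases hc : ((Finset.Icc i j).filter fun t => n t ≠ 1).card ≤ N
    · exact ih n hn hc
    obtain ⟨k, hk⟩ : ((Finset.Icc i j).filter fun t => n t ≠ 1).Nonempty :=
      Finset.card_pos.mp (by omega)
    obtain ⟨hkI, hnk⟩ := Finset.mem_filter.mp hk
    have hn1 : PosOn (Function.update n k 1) i j := fun t ht => by
      rcases eq_or_ne t k with rfl | htk
      · rw [Function.update_self]; exact Nat.one_pos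
      · rw [Function.update_of_ne htk]; exact hn t ht
    have hcard1 : ((Finset.Icc i j).filter fun t => Function.update n k 1 t ≠ 1).card ≤ N := by
      have hsub : ((Finset.Icc i j).filter fun t => Function.update n k 1 t ≠ 1) ⊆
          ((Finset.Icc i j).filter fun t => n t ≠ 1).erase k := fun t ht => by
        obtain ⟨htI, ht1⟩ := Finset.mem_filter.mp ht
        have htk : t ≠ k := fun e => by rw [e, Function.update_self] at ht1; exact ht1 rfl
        rw [Function.update_of_ne htk] at ht1
        exact Finset.mem_erase.mpr ⟨htk, Finset.mem_filter.mpr ⟨htI, ht1⟩⟩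
      have := Finset.card_le_card hsub
      rw [Finset.card_erase_of_mem hk] at this
      omega
    rw [b31_reduce hB hj hys hym hkI hn, ih _ hn1 hcard1, Submodule.smul_sup, ← Submodule.mul_smul,
      sup_assoc]
    have e1 : tailIdeal xs k ^ (n k - 1) * prodPow xs (fun t => Function.update n k 1 t - 1) i j =
        prodPow xs (fun t => n t - 1) i j := by
      rw [prodPow_eq_pow_mul_update_zero (f := fun t => n t - 1) hkI]
      congr 1
      refine prodPow_congr fun t _ => ?_
      rcases eq_or_ne t k with rfl | htk
      · rw [Function.update_self, Function.update_self]
      · rw [Function.update_of_ne htk, Function.update_of_ne htk]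
    rw [e1]
    congr 1
    exact sup_eq_right.mpr Submodule.smul_le_right

end Kawasaki

namespace IsPStandard

variable [IsNoetherianRing R] [Module.Finite R M] {xs : List R}

/-- **(3.1.7)** (Kawasaki 2000, proof of Thm. 3.1, Step 6): for a subsystem of parameters
`Y, y_u` of `M/qᵢ₊₁M` and `i < l ≤ d` (`0`-based),
`(Y, xᵢ₊₁)M : y_u ∩ (Y, xᵢ₊₁,…,x_l)M = (Y, xᵢ₊₁)M`, by induction on `l`: with `a = x_lb + c` on
the left, (2.9.2) for `Y, xᵢ₊₁,…,x_{l-1}, y_u, x_l` on `M/q_{l+1}M` gives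
`b ∈ (Y,xᵢ₊₁,…,x_{l-1})M : y_ux_l = … : x_l`. [cite: Kawasaki2000, Thm. 3.1, Step 6 (3.1.7)] -/
theorem kawasaki317 (hx : IsPStandard M xs) {i : ℕ} {Y : List R} {yu : R}
    (hys : IsSecantSequence M (xs.drop i ++ (Y ++ [yu]))) (hym : ∀ y ∈ Y ++ [yu], y ∈ maximalIdeal R)
    {l : ℕ} (hil : i < l) (hl : l ≤ xs.length) :
    colonBy (ofList (Y ++ [xs[i]'(by omega)]) • ⊤ : Submodule R M) yu ⊓ ofList (Y ++ seg xs i l) • ⊤ =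
      ofList (Y ++ [xs[i]'(by omega)]) • ⊤ := by
  classical
  have hi : i < xs.length := by omega
  have hS := hx.mem_maximalIdeal_drop_append i hym
  induction l, hil using Nat.le_induction with
  | base =>
    rw [seg_succ le_rfl hi, seg_self, List.nil_append]
    exact inf_eq_right.mpr (le_colonBy _ _)
  | succ l hil ih =>
    have hl' : l < xs.length := by omega
    have hil' : i ≤ l := Nat.le_of_succ_le hil
    refine le_antisymm ?_ (le_inf (le_colonBy _ _) (Submodule.smul_mono_left
      (ofList_mono_of_subset fun r hr => ?_)))
    swap
    · rcases List.mem_append.mp hr with hr | hr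
      · exact List.mem_append_left _ hr
      · rw [List.mem_singleton] at hr; rw [hr]
        exact List.mem_append_right _ (getElem_mem_seg le_rfl (by omega) hl)
    intro a ha
    obtain ⟨ha1, ha2⟩ := Submodule.mem_inf.mp ha
    refine (ih hl'.le).le (Submodule.mem_inf.mpr ⟨ha1, ?_⟩)
    rw [seg_succ hil' hl', ← List.append_assoc, ofList_append_smul, ofList_singleton] at ha2
    obtain ⟨c, hc, t, ht, e1⟩ := Submodule.mem_sup.mp ha2
    obtain ⟨b, -, rfl⟩ := mem_span_singleton_smul_iff.mp ht
    -- `b ∈ (Y, xᵢ₊₁,…,x_{l-1})M : y_ux_l = … : x_l` by (2.9.2)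
    have hyua : yu • a ∈ (ofList (Y ++ seg xs i l) • ⊤ : Submodule R M) := by
      rw [mem_colonBy] at ha1
      refine (Submodule.smul_mono_left (ofList_mono_of_subset fun r hr => ?_)) ha1
      rcases List.mem_append.mp hr with hr | hr
      · exact List.mem_append_left _ hr
      · rw [List.mem_singleton] at hr; rw [hr]
        exact List.mem_append_right _ (getElem_mem_seg le_rfl hil hl'.le)
    have hys2 : IsSecantSequence M (xs.drop (l + 1) ++ (((Y ++ seg xs i l) ++ [yu]) ++ [xs[l]])) := by
      refine hys.of_subperm ⟨seg xs i l ++ [xs[l]] ++ xs.drop (l + 1) ++ (Y ++ [yu]),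
        List.perm_iff_count.mpr fun r => by simp only [List.count_append]; omega, ?_⟩ hS
      rw [List.append_assoc (seg xs i l), List.singleton_append, ← List.drop_eq_getElem_cons hl',
        seg_append_drop hil']
    have hym2 : ∀ y ∈ ((Y ++ seg xs i l) ++ [yu]) ++ [xs[l]], y ∈ maximalIdeal R := by
      intro y hy
      simp only [List.mem_append, List.mem_singleton] at hy
      rcases hy with ((hy | hy) | rfl) | rfl
      · exact hym y (List.mem_append_left _ hy)
      · exact hx.mem_maximalIdeal y (List.mem_of_mem_drop ((seg_sublist_drop xs i l).subset hy))
      · exact hym _ (by simp)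
      · exact hx.mem_maximalIdeal _ (List.getElem_mem hl')
    have key := hx.colonBy_mul_eq_colonBy_nil (X₀ := xs.take (l + 1)) (D := xs.drop (l + 1))
      (List.take_append_drop _ xs).symm hys2 hym2 (Y := (Y ++ seg xs i l) ++ [yu]) (yu := xs[l])
      rfl (Or.inr (hx.kills (xs.take l) xs[l] (xs.drop (l + 1))
        (by rw [← List.drop_eq_getElem_cons hl', List.take_append_drop])))
      (m := (Y ++ seg xs i l).length) (by simp)
    have e2 : (((Y ++ seg xs i l) ++ [yu]) ++ [xs[l]]).take (Y ++ seg xs i l).length =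
        Y ++ seg xs i l := by rw [List.append_assoc, List.take_left]
    have e3 : (((Y ++ seg xs i l) ++ [yu]) ++ [xs[l]])[(Y ++ seg xs i l).length]'(by simp) = yu := by
      simp [List.getElem_append_right]
    rw [e2, e3] at key
    have hb : b ∈ colonBy (ofList (Y ++ seg xs i l) • ⊤ : Submodule R M) (yu * xs[l]) := by
      rw [mem_colonBy, mul_smul]
      have e : yu • (xs[l] • b) = yu • a - yu • c := by rw [← e1, smul_add]; abel
      rw [e]
      exact Submodule.sub_mem _ hyua (Submodule.smul_mem _ _ hc)
    rw [key, mem_colonBy] at hb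
    rw [← e1]
    exact Submodule.add_mem _ hc hb

/-- **(3.1.3) with all exponents `1`** (Kawasaki 2000, proof of Thm. 3.1, Step 6, main part), given
`(C_ii)`, `(C_{i+1,j})`, `(E_{i+1,j})`, `i < j`: for a subsystem of parameters `Y, y_u` of
`M/qᵢM`, `[(Y)M + qᵢq_{i+1}⋯qⱼM] : y_u ⊆ (Y)M : y_u + q_{i+1}⋯qⱼM`. As printed: `(C_{i+1,j})`
gives `a ∈ (Y,xᵢ)M : y_u + q_{i+1}⋯qⱼM`, `(C_ii)` gives `a ∈ (Y)M : y_u + qᵢM`; hence (modular law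
and (3.1.7)) `a ∈ (Y)M : y_u + q_{i+1}⋯qⱼM + xᵢM`; intersecting with
`[(Y)M + q_{i+1}⋯qⱼM] : y_u` and using `(E_{i+1,j})` (`… : y_uxᵢ = … : xᵢ`) removes the `xᵢM`.
[cite: Kawasaki2000, Thm. 3.1, Step 6] -/
theorem kawasakiC31_ones (hx : IsPStandard M xs) {i j : ℕ} (hij : i + 1 ≤ j) (hj : j < xs.length)
    (hCii : Kawasaki.C31 M xs i i) (hC1 : Kawasaki.C31 M xs (i + 1) j)
    (hE1 : Kawasaki.E31 M xs (i + 1) j) {Y : List R} {yu : R}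
    (hys : IsSecantSequence M (xs.drop i ++ (Y ++ [yu]))) (hym : ∀ y ∈ Y ++ [yu], y ∈ maximalIdeal R) :
    colonBy (ofList Y • ⊤ ⊔ prodPow xs (fun _ => 1) i j • ⊤ : Submodule R M) yu ≤
      colonBy (ofList Y • ⊤ : Submodule R M) yu ⊔ prodPow xs (fun _ => 1) (i + 1) j • ⊤ := by
  classical
  have hi : i < xs.length := by omega
  have hS := hx.mem_maximalIdeal_drop_append i hym
  -- notation: `W = q_{i+1}⋯qⱼ`, `Q₁ = qᵢ W`
  have hQ1 : prodPow xs (fun _ => 1) i j = tailIdeal xs i * prodPow xs (fun _ => 1) (i + 1) j := by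
    rw [prodPow_eq_mul _ (by omega : i ≤ j), pow_one]
  have hW : prodPow xs (fun _ : ℕ => 1) (i + 1) j ≤ tailIdeal xs (i + 1) :=
    prodPow_le_tailIdeal (Finset.mem_Icc.mpr ⟨le_rfl, hij⟩) Nat.one_pos
  -- the subsystem of parameters `Y, xᵢ, y_u` of `M/q_{i+1}M`
  have hys' : IsSecantSequence M (xs.drop (i + 1) ++ ((Y ++ [xs[i]]) ++ [yu])) := by
    refine hys.of_perm ?_ hS
    rw [List.drop_eq_getElem_cons hi]
    exact List.perm_iff_count.mpr fun r => by
      simp only [List.count_append, List.count_cons, List.count_nil]; omega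
  have hym' : ∀ y ∈ (Y ++ [xs[i]]) ++ [yu], y ∈ maximalIdeal R := by
    intro y hy
    simp only [List.mem_append, List.mem_singleton] at hy
    rcases hy with (hy | rfl) | rfl
    · exact hym y (List.mem_append_left _ hy)
    · exact hx.mem_maximalIdeal _ (List.getElem_mem hi)
    · exact hym _ (by simp)
  intro a ha
  -- (1) `(C_{i+1,j})` with the exponent `2` at `i+1`: `a ∈ (Y,xᵢ)M : y_u + WM`
  set n₂ : ℕ → ℕ := Function.update (fun _ => 1) (i + 1) 2 with hn₂
  have hn₂pos : Kawasaki.PosOn n₂ (i + 1) j := fun t _ => by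
    rcases eq_or_ne t (i + 1) with rfl | ht
    · rw [hn₂, Function.update_self]; exact Nat.succ_pos 1
    · rw [hn₂, Function.update_of_ne ht]; exact Nat.one_pos
  have hW2 : prodPow xs n₂ (i + 1) j = tailIdeal xs (i + 1) * prodPow xs (fun _ => 1) (i + 1) j := by
    rw [prodPow_eq_mul _ hij, prodPow_eq_mul (fun _ : ℕ => 1) hij, hn₂, Function.update_self, pow_two,
      pow_one, mul_assoc, prodPow_congr (n' := fun _ => 1) (fun t ht => Function.update_of_ne
        (by rw [Finset.mem_Icc] at ht; omega) _ _)]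
  have ha1 : a ∈ colonBy (ofList (Y ++ [xs[i]]) • ⊤ ⊔ prodPow xs n₂ (i + 1) j • ⊤ : Submodule R M) yu := by
    refine colonBy_mono ?_ _ ha
    refine sup_le (le_sup_left.trans' (Submodule.smul_mono_left (ofList_mono_of_subset fun r hr =>
      List.mem_append_left _ hr))) ?_
    rw [hQ1, hW2, ofList_append_smul, ofList_singleton]
    refine (Submodule.smul_mono_left (Ideal.mul_mono_left (tailIdeal_eq_span_sup hi).le)).trans ?_
    rw [Ideal.sup_mul, Submodule.sup_smul]
    exact sup_le (le_sup_left.trans' (le_sup_right.trans' (Submodule.smul_mono_left Ideal.mul_le_right)))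
      le_sup_right
  have hC1' := hC1 n₂ hn₂pos (Y ++ [xs[i]]) yu hys' hym' ha1
  have hupd : prodPow xs (Function.update n₂ (i + 1) (n₂ (i + 1) - 1)) (i + 1) j =
      prodPow xs (fun _ => 1) (i + 1) j := by
    refine prodPow_congr fun t _ => ?_
    rcases eq_or_ne t (i + 1) with rfl | ht
    · rw [Function.update_self, hn₂, Function.update_self]
    · rw [Function.update_of_ne ht, hn₂, Function.update_of_ne ht]
  rw [hupd] at hC1'
  -- (2) `(C_ii)` with the exponent `2`: `a ∈ (Y)M : y_u + qᵢM`
  have ha2 : a ∈ colonBy (ofList Y • ⊤ ⊔ prodPow xs (fun _ => 2) i i • ⊤ : Submodule R M) yu := by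
    refine colonBy_mono (sup_le_sup_left (Submodule.smul_mono_left ?_) _) _ ha
    rw [prodPow_self, hQ1, pow_two]
    exact Ideal.mul_mono_right (hW.trans (tailIdeal_antitone xs (Nat.le_succ i)))
  have hCii' := hCii (fun _ => 2) (fun _ _ => Nat.succ_pos 1) Y yu hys hym ha2
  rw [prodPow_self, Function.update_self, pow_one] at hCii'
  -- (3) `x - z ∈ (Y,xᵢ)M : y_u ∩ qᵢM ⊆ (Y, xᵢ)M` by (3.1.7)
  obtain ⟨x, hxX, w, hw, e1⟩ := Submodule.mem_sup.mp hC1'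
  obtain ⟨z, hz, t, htT, e2⟩ := Submodule.mem_sup.mp hCii'
  have hT : (tailIdeal xs i • ⊤ : Submodule R M) ≤ ofList (Y ++ seg xs i xs.length) • ⊤ := by
    rw [seg_length, ofList_append_smul]
    exact le_sup_right
  have h317 := hx.kawasaki317 hys hym hi le_rfl
  have hxz : x - z ∈ (ofList (Y ++ [xs[i]]) • ⊤ : Submodule R M) := by
    rw [← h317]
    refine Submodule.mem_inf.mpr ⟨Submodule.sub_mem _ hxX (colonBy_mono (Submodule.smul_mono_left
      (ofList_mono_of_subset fun r hr => List.mem_append_left _ hr)) _ hz), hT ?_⟩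
    have e : x - z = t - w := by
      have : x + w = z + t := e1.trans e2.symm
      rw [sub_eq_sub_iff_add_eq_add, this, add_comm]
    rw [e]
    exact Submodule.sub_mem _ htT ((Submodule.smul_mono_left (hW.trans
      (tailIdeal_antitone xs (Nat.le_succ i)))) hw)
  rw [ofList_append_smul, ofList_singleton] at hxz
  obtain ⟨y₀, hy₀, s, hs, e3⟩ := Submodule.mem_sup.mp hxz
  obtain ⟨m, -, rfl⟩ := mem_span_singleton_smul_iff.mp hs
  -- (4) `a = (z + y₀ + w) + xᵢm` with `z + y₀ + w ∈ (Y)M : y_u + WM`; intersect with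
  -- `[(Y)M + WM] : y_u` and use `(E_{i+1,j})`
  have hU : a ∈ colonBy (ofList Y • ⊤ ⊔ prodPow xs (fun _ => 1) (i + 1) j • ⊤ : Submodule R M) yu := by
    refine colonBy_mono (sup_le_sup_left (Submodule.smul_mono_left ?_) _) _ ha
    rw [hQ1]; exact Ideal.mul_le_left
  have hrest : z + y₀ + w ∈ colonBy (ofList Y • ⊤ : Submodule R M) yu ⊔
      prodPow xs (fun _ => 1) (i + 1) j • ⊤ :=
    Submodule.add_mem _ (Submodule.mem_sup_left (Submodule.add_mem _ hz (le_colonBy _ _ hy₀)))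
      (Submodule.mem_sup_right hw)
  have hZW : colonBy (ofList Y • ⊤ : Submodule R M) yu ⊔ prodPow xs (fun _ => 1) (i + 1) j • ⊤ ≤
      colonBy (ofList Y • ⊤ ⊔ prodPow xs (fun _ => 1) (i + 1) j • ⊤ : Submodule R M) yu :=
    sup_le (colonBy_mono le_sup_left _) (le_sup_right.trans (le_colonBy _ _))
  have e4 : a = (z + y₀ + w) + xs[i] • m := by
    have : x = z + (y₀ + xs[i] • m) := by rw [e3]; abel
    rw [← e1, this]; abel
  have hxm : xs[i] • m ∈ colonBy (ofList Y • ⊤ ⊔ prodPow xs (fun _ => 1) (i + 1) j • ⊤ :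
      Submodule R M) yu := by
    have := Submodule.sub_mem _ hU (hZW hrest)
    rwa [e4, add_sub_cancel_left] at this
  -- `(E_{i+1,j})` for `Y, y_u, xᵢ` on `M/q_{i+1}M`: `[(Y)M + WM] : y_uxᵢ = [(Y)M + WM] : xᵢ`
  have hysE : IsSecantSequence M (xs.drop (i + 1) ++ ((Y ++ [yu]) ++ [xs[i]])) := by
    refine hys.of_perm ?_ hS
    rw [List.drop_eq_getElem_cons hi]
    exact List.perm_iff_count.mpr fun r => by
      simp only [List.count_append, List.count_cons, List.count_nil]; omega
  have hymE : ∀ y ∈ (Y ++ [yu]) ++ [xs[i]], y ∈ maximalIdeal R := by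
    intro y hy
    rcases List.mem_append.mp hy with hy | hy
    · exact hym y hy
    · rw [List.mem_singleton] at hy; rw [hy]
      exact hx.mem_maximalIdeal _ (List.getElem_mem hi)
  have hE := hE1 (fun _ => 1) (Kawasaki.posOn_one _ _) (i + 1) le_rfl ((Y ++ [yu]) ++ [xs[i]])
    (Y ++ [yu]) xs[i] rfl hysE hymE (hx.kills (xs.take i) xs[i] (xs.drop (i + 1))
      (by rw [← List.drop_eq_getElem_cons hi, List.take_append_drop]))
    Y.length (by simp) [] (List.nil_sublist _)
  have e5 : ((Y ++ [yu]) ++ [xs[i]]).take Y.length ++ [] = Y := by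
    rw [List.append_nil, List.append_assoc, List.take_left]
  have e6 : ((Y ++ [yu]) ++ [xs[i]])[Y.length]'(by simp) = yu := by
    simp [List.getElem_append_right]
  rw [e5, e6] at hE
  have hm : m ∈ colonBy (ofList Y • ⊤ ⊔ prodPow xs (fun _ => 1) (i + 1) j • ⊤ : Submodule R M)
      (yu * xs[i]) := by
    rwa [mem_colonBy, mul_smul]
  rw [hE, mem_colonBy] at hm
  have hle : (ofList Y • ⊤ ⊔ prodPow xs (fun _ => 1) (i + 1) j • ⊤ : Submodule R M) ≤
      colonBy (ofList Y • ⊤ : Submodule R M) yu ⊔ prodPow xs (fun _ => 1) (i + 1) j • ⊤ :=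
    sup_le (le_sup_left.trans' (le_colonBy _ _)) le_sup_right
  rw [e4]
  exact Submodule.add_mem _ hrest (hle hm)

/-- **Step 6 of Kawasaki 2000, Thm. 3.1: if `j > i`, then `(C_ij)` comes from `(B_ij)`, `(C_ii)`,
`(C_{i+1,j})` and `(E_{i+1,j})`** (general exponents by `Kawasaki.b31_iterate_gen`: "In the same
way as Step 3, we may assume that `nᵢ = ⋯ = nⱼ = 1`"). [cite: Kawasaki2000, Thm. 3.1, Step 6] -/
theorem kawasakiC31_of_succ (hx : IsPStandard M xs) {i j : ℕ} (hij : i + 1 ≤ j) (hj : j < xs.length)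
    (hB : Kawasaki.B31 M xs i j) (hCii : Kawasaki.C31 M xs i i) (hC1 : Kawasaki.C31 M xs (i + 1) j)
    (hE1 : Kawasaki.E31 M xs (i + 1) j) : Kawasaki.C31 M xs i j := by
  classical
  intro n hn Y yu hys hym
  rw [Kawasaki.b31_iterate_gen hB hj hys hym hn]
  refine sup_le ?_ le_sup_left
  refine (Submodule.smul_mono le_rfl (hx.kawasakiC31_ones hij hj hCii hC1 hE1 hys hym)).trans ?_
  rw [Submodule.smul_sup, ← Submodule.mul_smul]
  refine sup_le (Submodule.smul_le_right.trans le_sup_left)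
    (le_sup_right.trans' (Submodule.smul_mono_left ?_))
  -- `(∏ q_t^{n_t-1}) · q_{i+1}⋯qⱼ = qᵢ^{nᵢ-1}q_{i+1}^{n_{i+1}}⋯qⱼ^{nⱼ}`
  have hc : prodPow xs (Function.update n i (n i - 1)) (i + 1) j = prodPow xs n (i + 1) j :=
    prodPow_congr fun t ht => Function.update_of_ne (by rw [Finset.mem_Icc] at ht; omega) _ _
  rw [prodPow_eq_mul _ (by omega : i ≤ j), prodPow_eq_mul _ (by omega : i ≤ j), Function.update_self,
    mul_assoc, hc]
  refine Ideal.mul_mono_right ?_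
  -- `∏_{t>i} q_t^{n_t - 1} · ∏_{t>i} q_t = ∏_{t>i} q_t^{n_t}`
  rw [prodPow, prodPow, prodPow, ← Finset.prod_mul_distrib]
  refine le_of_eq (Finset.prod_congr rfl fun t ht => ?_)
  rw [pow_one, ← pow_succ, Nat.sub_add_cancel (hn t (by rw [Finset.mem_Icc] at ht ⊢; omega))]

end IsPStandard

end Literature.AlgebraicGeometry.Resolution
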